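import Summits.HodgeConjecture.HodgeConjecture.Theorems.F0P3cStCharTSKeys3JacquetSemisimple     -- ★ N = 3 twin (F0P2-p06): GENERIC §1 `eigenfunctional_comp_mk_of_scalar`, §2 `apply_eq_smul_of_one_vector`, `exists_functional_comp_not_proportional`
import Summits.HodgeConjecture.HodgeConjecture.Theorems.F0P3cU2PrincipalSeriesJacquetFiltration   -- ★ N = 2 assets: (γ-W)₂ `torus_normalizedJacquet_openCellLine_eq_weylChar_two`, generic closed∕open cell, (L-q)₂ (L-ℓ)₂, `hasCompactSupport_cellFun_cmBorel_two`, Bruhat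
import HarnessLib

/-!
# R90-TF · S4 (Ch. 13.1–2) · ROAD «KEYS2-ANALYTIC» brick (α) — «JACQUET SEMISIMPLE FROM ONE VECTOR» on `U(Φ₂)(L⁺_v)`, `v` non-split, `wχ = χ`:
# if ONE section `f₀ ∈ i(χ₁, χ₂)` with `f₀(1) = 1` has `r_B(m)[f₀] = χ(m)[f₀]` for all `m ∈ T`, then `i(χ₁, χ₂)` carries a `(B, χδ_B^{1/2})`-eigenfunctional NOT proportional to `ev₁`

Cell `hodgecm-mathlib`, crux H413 (`stmt-HodgeConjecture-24833`), route of record `HCCMUnconditional`; programme R90-TF (brief `director/R90-BRIEF.v2.md`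
1f40d54518340a35), section S4 = Rogawski Ch. 13.1–2 (base `R90-C131`, dealer K2E2-plan (g6)); ROAD «KEYS2-ANALYTIC» of R90-C131-p05 (g0) (memo
`R90/R90-C131-p05/g0/MEMO-KEYS2-analytic-road.v1.md` e8546b45370d4f86, «(α), (β) are pure ports — free hands welcome BY NAME»), brick **(α)** taken by seat
R90-C131-p04 (g0) (R90 bus 2026-09-04T22:26:46Z).  The road closes S4 FILE B's named analytic input `stub_R90_S4_U2_ldsDecomp` (Keys–Shahidi reducibility of the
unitary principal series of `U(Φ₂)` at `χ₁|_{F^×} = ω_{E/F}`) via ★ p862353 `stub_R90_S4_U2_ldsDecomp_of_reducible`; (α) is its ALGEBRAIC end, the N = 2 port of ★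
`F0P3cStCharTSKeys3JacquetSemisimple` §3 (line LH6 «StCharTS», road «KEYS3-ANALYTIC», N = 3).  Lane `--supports stmt-HodgeConjecture-24833 --as helper`; THEOREMS
ONLY (0 def ∕ 0 instance ∕ 0 notation ∕ 0 sorry); ★-only imports (Theorems ∕ Literature).

THE MATHEMATICS ([Keys1984 §3, §7]; [Casselman1995 §6.3, Lemma 7.1.1 (a)]; [BernsteinZelevinsky1977 §2.3, Geometrical Lemma 2.12]; [Rogawski1990 §12.1 p. 171]).
`G = U(Φ₂)(L⁺_v)`, `v` non-split, `B = TN` its Borel, `χ = (χ₁, χ₂)` a continuous character of `T ≅ E_v^× ×' E¹_v` (★ `torusCharPair … 0 χ₁ χ₂`: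
`d ↦ χ₁(d₀₀) χ₂(det d)`), `wχ = (χ̄₁⁻¹, χ₂)` (★ `weylTorusCharPair`), `I = i_G(χ)` (★ `cmPrincipalSeries L 2 v χ`, normalised induction), `r_B` its normalised Jacquet
module (★ `normalizedJacquet`; two-dimensional, ★ `u2PrincipalSeries_jacquetFiltration`).  The Geometrical Lemma filters `r_B I` by the CLOSED CELL: the line
`ℓ = {[f] : f(1) = 0}` (★ generic `evalJacquetKer`, codimension ≤ 1) on which `T` acts by `wχ` (★ (γ-W)₂ `torus_normalizedJacquet_openCellLine_eq_weylChar_two`), with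
`(r_B(m) − χ(m)) r_B I ⊆ ℓ`; the open-cell bound makes every such `ℓ` a line (★ generic `finrank_le_of_forall_mem_iff_exists_toFun_one_eq_zero_normalizedInd` over the
`U(1,1)` Bruhat decomposition ★ `u2LocalBruhatDecomposition` and ★ `hasCompactSupport_cellFun_cmBorel_two`).  When `wχ = χ` (e.g. `χ₁|_{F^×} = ω`, §1) the torus acts
on `ℓ` AND on `r_B I ∕ ℓ` by the same scalar `χ`, so `r_B(m) − χ(m)` is nilpotent; it is ZERO as soon as ONE class `[f₀] ∉ ℓ` (i.e. `f₀(1) ≠ 0`, ★ (L-q)₂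
`exists_linearMap_coinvariants_cmPrincipalSeries`: `ev₁` factors through `r_B`) is a `χ`-eigenvector (★ generic `apply_eq_smul_of_one_vector`).  Then `T` acts on
`r_B I` by `χ`, every functional `φ` on `r_B I` gives a `(B, χ δ_B^{1/2})`-eigenfunctional `ℓ = φ ∘ [·]` on `I` (★ generic `eigenfunctional_comp_mk_of_scalar`), and
choosing `φ` non-zero on the class of an open-cell section `Φ` with `Φ(1) = 0`, `[Φ] ≠ 0` (★ (L-ℓ)₂ `exists_cmPrincipalSeries_toFun_one_eq_zero_and_mk_ne_zero`) makes
`ℓ` NOT proportional to `ev₁` (★ generic `exists_functional_comp_not_proportional`).  That second eigenfunctional is the `hSecond` input from which ★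
`F0P3cStCharTSKeysRedOfEigenfunctional.exists_ne_bot_ne_top_of_eigenfunctional L 2 v χ` (GENERIC in `N`) produces `⊥ ≠ N ≠ ⊤` in `I` — the (RED) target of the road.
* §1 `weylTorusCharPair_eq_torusCharPair_of_isQuadraticCharExtension` (generic `U(σ, Φ_N)(R)`, `σ` an involution): `χ₁|_{R^σ} = ω` (★ `IsQuadraticCharExtension σ χ₁`:
  on `σ`-fixed units `χ₁ = 1` exactly on norms) ⇒ `wχ = χ` (the norms `σ(a)·a` are fixed, so `χ₁(σ a) χ₁(a) = 1`); CM reading `cmTwo_weylTorusCharPair_eq_of_isQuadraticCharExtension`.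
* §2 **`secondEigenfunctional_of_one_vector_two`** — the memo's HEAD (α), binder for binder (the two conjuncts are EXACTLY the two hypotheses of ★
  `exists_ne_bot_ne_top_of_eigenfunctional L 2 v χ ℓ`).

HONEST LABEL: HC_CM is proved only modulo the 7 printed citations (2 remaining named inputs: hLiu418 = `stmt-HodgeConjecture-24832`, h413 = `stmt-HodgeConjecture-24833`)
until rung 0 closes; this brick discharges nothing by itself — `stub_R90_S4_U2_ldsDecomp` falls only when (β), (ε2), (ζ) dock on §2's one-vector hypothesis.  REL ≠ ★ ≠ BUILT.

## References
* [Keys1984] D. Keys, *Principal series representations of special unitary groups over local fields*, Compositio Math. 51 (1984), §3; §7 Thm. (1) p. 126.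
* [Casselman1995] W. Casselman, *Introduction to the theory of admissible representations of p-adic reductive groups* (1995), §3.2; §6.3; Lemma 7.1.1 (a) p. 67.
* [BernsteinZelevinsky1977] I. N. Bernstein, A. V. Zelevinsky, *Induced representations of reductive p-adic groups I*, Ann. Sci. ÉNS 10 (1977), §1.8, §2.3,
  Geometrical Lemma 2.12, Cor. 2.13 (c).
* [Rogawski1990] J. D. Rogawski, *Automorphic Representations of Unitary Groups in Three Variables*, Ann. of Math. Stud. 123 (1990), §11.1 p. 161 case 2);
  §12.1 p. 171; §12.2 pp. 173–174; §4.8 p. 51 (`μ|_{F^×} = ω_{E/F}`).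
-/

set_option autoImplicit false
-- the mandated namespace repeats the single-problem summit's segment (`HodgeConjecture.HodgeConjecture`)
set_option linter.dupNamespace false

noncomputable section

open NumberField IsDedekindDomain
open scoped Matrix MatrixGroups
open Literature.NumberTheory.Rogawski1990 Literature.NumberTheory.Automorphic Literature.NumberTheory.Automorphic.UnitaryGroup
open Summit.HodgeConjecture.HodgeConjecture.Cruxes.H413
open Summit.HodgeConjecture.HodgeConjecture.Cruxes.H413.F0P3U3PrincipalSeriesJacquetClosedCell
open Summit.HodgeConjecture.HodgeConjecture.Cruxes.H413.F0P3U3PrincipalSeriesJacquetFiltrationHolds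
open Summit.HodgeConjecture.HodgeConjecture.Cruxes.H413.F0P3cStCharTSKeys3JacquetSemisimple

namespace Summit.HodgeConjecture.HodgeConjecture.R90.S4

/-! ## §1 `χ₁|_{R^σ} = ω` ⇒ `wχ = χ` (generic `U(σ, Φ_N)(R)`) -/

section Generic

variable {R : Type*} [CommRing R] (σ : R →+* R)

/-- **`χ₁|_{R^σ} = ω_{E/F}` ⇒ `w(χ₁, χ₂) = (χ₁, χ₂)`** on the diagonal torus of `U(σ, Φ_N)(R)`, `σ` an involution, any coordinate `i`: by ★ `IsQuadraticCharExtension σ χ₁`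
the character `χ₁` is trivial on every NORM `σ(a)·a` (a `σ`-fixed unit), i.e. `χ₁(σ a)⁻¹ = χ₁(a)`, which is `wχ = χ` entry by entry (★ `weylTorusCharPair_apply`,
★ `torusCharPair_apply`; the `←` half of ★ `weylTorusCharPair_eq_iff`, generic `N`). [cite: Rogawski1990, §12.2 p. 173; §4.8 p. 51] [cite: Keys1984, §7] -/
theorem weylTorusCharPair_eq_torusCharPair_of_isQuadraticCharExtension (hσ : ∀ x : R, σ (σ x) = x) {N : ℕ} (J : Matrix (Fin N) (Fin N) R)
    (hJ : J = (StdForm.antidiagonal N).over R) (i : Fin N) (χ₁ : Rˣ →* ℂˣ) (χ₂ : ↥(normOneUnits σ) →* ℂˣ) (hq : IsQuadraticCharExtension σ χ₁) :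
    weylTorusCharPair σ J hJ i χ₁ χ₂ = torusCharPair σ J hJ i χ₁ χ₂ := by
  ext t
  rw [weylTorusCharPair_apply, torusCharPair_apply]
  congr 2
  -- `χ₁(σ a)⁻¹ = χ₁(a)` from `χ₁(σ(a)·a) = 1`, `σ(a)·a` a `σ`-fixed norm
  set a : Rˣ := torusEntry σ J i t with ha
  have hfix : σ ((Units.map (σ : R →* R) a * a : Rˣ) : R) = (Units.map (σ : R →* R) a * a : Rˣ) := by
    rw [Units.val_mul, Units.coe_map, MonoidHom.coe_coe, map_mul, hσ, mul_comm]
  have hnorm : χ₁ (Units.map (σ : R →* R) a * a) = 1 :=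
    (hq _ hfix).2 ⟨a, by rw [Units.val_mul, Units.coe_map, MonoidHom.coe_coe]⟩
  rw [map_mul] at hnorm
  exact inv_eq_of_mul_eq_one_right hnorm

end Generic

section CMTwo

variable (L : Type) [Field L] [NumberField L] [IsCMField L] (v : HeightOneSpectrum (𝓞 ↥(maximalRealSubfield L)))

/-- **CM reading, `N = 2`**: on the torus of `U(Φ₂)(L⁺_v)`, `χ₁|_{F_v^×} = ω_{E_v/F_v}` (★ `IsQuadraticCharExtension (conjLocal …) χ₁`, the hypothesis of
`stub_R90_S4_U2_ldsDecomp`) ⇒ `wχ = χ` (§1 at the involution `c ⊗ 1`, ★ `conjLocal_conjLocal_cm`) — the `hw` binder of §2. [cite: Rogawski1990, §12.1 p. 171; §11.1 p. 161] -/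
theorem cmTwo_weylTorusCharPair_eq_of_isQuadraticCharExtension
    (χ₁ : (LocalRing L v)ˣ →* ℂˣ) (χ₂ : ↥(normOneUnits (conjLocal L (IsCMField.complexConj L) v)) →* ℂˣ)
    (hq : IsQuadraticCharExtension (conjLocal L (IsCMField.complexConj L) v) χ₁) :
    weylTorusCharPair (conjLocal L (IsCMField.complexConj L) v) (cmLocalForm L 2 v) (cmLocalForm_eq_over L 2 v) 0 χ₁ χ₂ =
      torusCharPair (conjLocal L (IsCMField.complexConj L) v) (cmLocalForm L 2 v) (cmLocalForm_eq_over L 2 v) 0 χ₁ χ₂ :=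
  weylTorusCharPair_eq_torusCharPair_of_isQuadraticCharExtension (conjLocal L (IsCMField.complexConj L) v) (conjLocal_conjLocal_cm L v)
    (cmLocalForm L 2 v) (cmLocalForm_eq_over L 2 v) 0 χ₁ χ₂ hq

end CMTwo

/-! ## §2 `U(Φ₂)(L⁺_v)`, `v` non-split, `wχ = χ`: the second eigenfunctional from ONE vector -/

section CM

variable (L : Type) [Field L] [NumberField L] [IsCMField L] (v : HeightOneSpectrum (𝓞 ↥(maximalRealSubfield L)))
  (hns : ∀ w : PlacesOver L v, IsCMField.complexConj L • w.1 = w.1)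

include hns in
set_option synthInstance.maxHeartbeats 400000 in
set_option maxHeartbeats 8000000 in
-- statement∕proof-heavy: the `SmoothInd` carrier of `cmPrincipalSeries` and the `rfl`-bridges `cmPrincipalSeries L 2 v χ = normalizedInd (cmBorelTriple L 2 v) (𝟙 ⊗ χ)`
-- of the closed∕open-cell packages (class of ★ `u2PrincipalSeries_jacquetFiltration`, same budget); the ★ packages are passed WHOLE to the generic §2 of the N = 3 twin
/-- **«THE SECOND EIGENFUNCTIONAL FROM ONE VECTOR», `U(Φ₂)(L⁺_v)`** (memo (α) HEAD, binder for binder).  `v` non-split, `χ₁, χ₂` continuous, `wχ = χ`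
(★ `weylTorusCharPair … 0 χ₁ χ₂ = torusCharPair … 0 χ₁ χ₂`; e.g. §1 under `IsQuadraticCharExtension`): if some section `f₀ ∈ i(χ₁, χ₂)` with `f₀(1) = 1` has
`r_B(m)[f₀] = χ(m)[f₀]` for every `m ∈ T`, then `r_B = χ·id` on the Jacquet module (★ generic closed cell `evalJacquetKer`, ★ open-cell bound over ★
`u2LocalBruhatDecomposition`, ★ (γ-W)₂ `torus_normalizedJacquet_openCellLine_eq_weylChar_two`, ★ (L-q)₂, ★ generic `apply_eq_smul_of_one_vector`) and `i(χ₁, χ₂)`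
carries a `(B, χδ_B^{1/2})`-eigenfunctional `ℓ` with `∀ c, ∃ f, ℓ f ≠ c · f(1)` (`ℓ = φ ∘ [·]`, ★ generic `eigenfunctional_comp_mk_of_scalar`; `φ` from ★ (L-ℓ)₂ via ★
generic `exists_functional_comp_not_proportional`) — the two conjuncts are EXACTLY the hypotheses of ★ `exists_ne_bot_ne_top_of_eigenfunctional L 2 v χ ℓ`.
[cite: Keys1984, §3; §7 Thm. (1)] [cite: Casselman1995, Lemma 7.1.1 (a), §6.3] [cite: BernsteinZelevinsky1977, §2.3, Geometrical Lemma 2.12] [cite: Rogawski1990, §12.1 p. 171] -/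
theorem secondEigenfunctional_of_one_vector_two
    (χ₁ : (LocalRing L v)ˣ →* ℂˣ) (χ₂ : ↥(normOneUnits (conjLocal L (IsCMField.complexConj L) v)) →* ℂˣ)
    (h₁ : Continuous fun x => ((χ₁ x : ℂˣ) : ℂ)) (h₂ : Continuous fun x => ((χ₂ x : ℂˣ) : ℂ))
    (hw : weylTorusCharPair (conjLocal L (IsCMField.complexConj L) v) (cmLocalForm L 2 v) (cmLocalForm_eq_over L 2 v) 0 χ₁ χ₂ =
      torusCharPair (conjLocal L (IsCMField.complexConj L) v) (cmLocalForm L 2 v) (cmLocalForm_eq_over L 2 v) 0 χ₁ χ₂)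
    (f₀ : haveI := locallyCompactSpace_cmBorelU L 2 v
      Representation.SmoothInd (cmBorelTriple L 2 v).P
        (Representation.twist (((Representation.trivial ℂ ↥(torusU (conjLocal L (IsCMField.complexConj L) v) (cmLocalForm L 2 v)) ℂ).twist
          (torusCharPair (conjLocal L (IsCMField.complexConj L) v) (cmLocalForm L 2 v) (cmLocalForm_eq_over L 2 v) 0 χ₁ χ₂)).comp (cmBorelTriple L 2 v).proj)
          (rootDeltaChar (cmBorelTriple L 2 v).P)))
    (hf₀ : f₀.toFun 1 = 1)
    (hJf₀ : haveI := locallyCompactSpace_cmBorelU L 2 v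
      ∀ m : ↥(cmBorelTriple L 2 v).M,
        (cmPrincipalSeries L 2 v (torusCharPair (conjLocal L (IsCMField.complexConj L) v) (cmLocalForm L 2 v) (cmLocalForm_eq_over L 2 v) 0 χ₁ χ₂)).normalizedJacquet
            (cmBorelTriple L 2 v) m
            (Representation.Coinvariants.mk ((cmBorelTriple L 2 v).restrict
              (cmPrincipalSeries L 2 v (torusCharPair (conjLocal L (IsCMField.complexConj L) v) (cmLocalForm L 2 v) (cmLocalForm_eq_over L 2 v) 0 χ₁ χ₂))) f₀) =
          ((torusCharPair (conjLocal L (IsCMField.complexConj L) v) (cmLocalForm L 2 v) (cmLocalForm_eq_over L 2 v) 0 χ₁ χ₂ m : ℂˣ) : ℂ) •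
            Representation.Coinvariants.mk ((cmBorelTriple L 2 v).restrict
              (cmPrincipalSeries L 2 v (torusCharPair (conjLocal L (IsCMField.complexConj L) v) (cmLocalForm L 2 v) (cmLocalForm_eq_over L 2 v) 0 χ₁ χ₂))) f₀) :
    haveI := locallyCompactSpace_cmBorelU L 2 v
    ∃ ℓ : Representation.SmoothInd (cmBorelTriple L 2 v).P
        (Representation.twist (((Representation.trivial ℂ ↥(torusU (conjLocal L (IsCMField.complexConj L) v) (cmLocalForm L 2 v)) ℂ).twist
          (torusCharPair (conjLocal L (IsCMField.complexConj L) v) (cmLocalForm L 2 v) (cmLocalForm_eq_over L 2 v) 0 χ₁ χ₂)).comp (cmBorelTriple L 2 v).proj)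
          (rootDeltaChar (cmBorelTriple L 2 v).P)) →ₗ[ℂ] ℂ,
      (∀ (p : ↥(cmBorelTriple L 2 v).P) (f : _),
        ℓ (cmPrincipalSeries L 2 v (torusCharPair (conjLocal L (IsCMField.complexConj L) v) (cmLocalForm L 2 v) (cmLocalForm_eq_over L 2 v) 0 χ₁ χ₂) p.1 f) =
          ((torusCharPair (conjLocal L (IsCMField.complexConj L) v) (cmLocalForm L 2 v) (cmLocalForm_eq_over L 2 v) 0 χ₁ χ₂ ((cmBorelTriple L 2 v).proj p) : ℂˣ) : ℂ) *
            ((rootDeltaChar (cmBorelTriple L 2 v).P p : ℂˣ) : ℂ) * ℓ f) ∧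
      ∀ c : ℂ, ∃ f, ℓ f ≠ c * f.toFun 1 := by
  haveI := locallyCompactSpace_cmBorelU L 2 v
  have hχc := continuous_torusCharPair_apply (conjLocal L (IsCMField.complexConj L) v) (cmLocalForm L 2 v) (cmLocalForm_eq_over L 2 v) 0 χ₁ χ₂ h₁ h₂
  -- (γ-W)₂, (L-ℓ)₂, (L-q)₂ — all in the `cmPrincipalSeries` spelling
  have hT := F0P3cU2PrincipalSeriesOpenCellTorusChar.torus_normalizedJacquet_openCellLine_eq_weylChar_two L v hns χ₁ χ₂ h₁ h₂
  have HD := exists_cmPrincipalSeries_toFun_one_eq_zero_and_mk_ne_zero L 2 v le_rfl _ hχc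
  have HL2 := exists_linearMap_coinvariants_cmPrincipalSeries L 2 v _ hχc
  -- Bruhat + (Supp)₂ for the open-cell bound
  have H0 := u2LocalBruhatDecomposition L v
  have H1 := H0 hns
  obtain ⟨w₀, hval, -, hBruhat, -⟩ := H1
  have hB : ∀ g : ↥(unitaryGroupOfForm (conjLocal L (IsCMField.complexConj L) v) (cmLocalForm L 2 v)),
      g ∈ (cmBorelTriple L 2 v).P ∨ ∃ p ∈ (cmBorelTriple L 2 v).P, ∃ n ∈ (cmBorelTriple L 2 v).N, g = p * w₀ * n := hBruhat
  have hS : ∀ f : Representation.SmoothInd (cmBorelTriple L 2 v).P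
      (Representation.twist
          (((Representation.trivial ℂ ↥(torusU (conjLocal L (IsCMField.complexConj L) v) (cmLocalForm L 2 v)) ℂ).twist
            (torusCharPair (conjLocal L (IsCMField.complexConj L) v) (cmLocalForm L 2 v) (cmLocalForm_eq_over L 2 v) 0 χ₁ χ₂)).comp (cmBorelTriple L 2 v).proj) (rootDeltaChar (cmBorelTriple L 2 v).P)),
      f.toFun 1 = 0 → HasCompactSupport fun n : ↥(cmBorelTriple L 2 v).N => f.toFun (w₀ * (n : ↥(unitaryGroupOfForm (conjLocal L (IsCMField.complexConj L) v) (cmLocalForm L 2 v)))) :=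
    fun f hf => F0P3bU2PrincipalSeriesJacquetRankLeTwo.hasCompactSupport_cellFun_cmBorel_two L v hns w₀ hval _ f hf
  have hN := isLimitOfCompactOpen_cmBorelTriple_N L 2 v
  have hδ := deltaChar_cmBorelTriple_eq_one_of_mem_N L 2 v
  -- (C)₂ the closed-cell kernel, transported to the `cmPrincipalSeries` spelling (`cmPrincipalSeries L 2 v χ = normalizedInd (cmBorelTriple L 2 v) (𝟙 ⊗ χ)`, `rfl`)
  have HC : ∃ ℓ : Submodule ℂ ((cmBorelTriple L 2 v).restrict (cmPrincipalSeries L 2 v (torusCharPair (conjLocal L (IsCMField.complexConj L) v) (cmLocalForm L 2 v) (cmLocalForm_eq_over L 2 v) 0 χ₁ χ₂))).Coinvariants,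
      (∀ (m : ↥(cmBorelTriple L 2 v).M), ∀ x ∈ ℓ, (cmPrincipalSeries L 2 v (torusCharPair (conjLocal L (IsCMField.complexConj L) v) (cmLocalForm L 2 v) (cmLocalForm_eq_over L 2 v) 0 χ₁ χ₂)).normalizedJacquet (cmBorelTriple L 2 v) m x ∈ ℓ) ∧
      (∀ (m : ↥(cmBorelTriple L 2 v).M) (x : ((cmBorelTriple L 2 v).restrict (cmPrincipalSeries L 2 v (torusCharPair (conjLocal L (IsCMField.complexConj L) v) (cmLocalForm L 2 v) (cmLocalForm_eq_over L 2 v) 0 χ₁ χ₂))).Coinvariants),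
        (cmPrincipalSeries L 2 v (torusCharPair (conjLocal L (IsCMField.complexConj L) v) (cmLocalForm L 2 v) (cmLocalForm_eq_over L 2 v) 0 χ₁ χ₂)).normalizedJacquet (cmBorelTriple L 2 v) m x - (((torusCharPair (conjLocal L (IsCMField.complexConj L) v) (cmLocalForm L 2 v) (cmLocalForm_eq_over L 2 v) 0 χ₁ χ₂) m : ℂˣ) : ℂ) • x ∈ ℓ) ∧
      FiniteDimensional ℂ (((cmBorelTriple L 2 v).restrict (cmPrincipalSeries L 2 v (torusCharPair (conjLocal L (IsCMField.complexConj L) v) (cmLocalForm L 2 v) (cmLocalForm_eq_over L 2 v) 0 χ₁ χ₂))).Coinvariants ⧸ ℓ) ∧ Module.finrank ℂ (((cmBorelTriple L 2 v).restrict (cmPrincipalSeries L 2 v (torusCharPair (conjLocal L (IsCMField.complexConj L) v) (cmLocalForm L 2 v) (cmLocalForm_eq_over L 2 v) 0 χ₁ χ₂))).Coinvariants ⧸ ℓ) ≤ 1 ∧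
      (∀ x, x ∈ ℓ ↔ ∃ f : Representation.SmoothInd (cmBorelTriple L 2 v).P
          (Representation.twist
          (((Representation.trivial ℂ ↥(torusU (conjLocal L (IsCMField.complexConj L) v) (cmLocalForm L 2 v)) ℂ).twist
            (torusCharPair (conjLocal L (IsCMField.complexConj L) v) (cmLocalForm L 2 v) (cmLocalForm_eq_over L 2 v) 0 χ₁ χ₂)).comp (cmBorelTriple L 2 v).proj) (rootDeltaChar (cmBorelTriple L 2 v).P)),
        f.toFun 1 = 0 ∧ Representation.Coinvariants.mk ((cmBorelTriple L 2 v).restrict (cmPrincipalSeries L 2 v (torusCharPair (conjLocal L (IsCMField.complexConj L) v) (cmLocalForm L 2 v) (cmLocalForm_eq_over L 2 v) 0 χ₁ χ₂))) f = x) :=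
    ⟨evalJacquetKer (cmBorelTriple L 2 v) ((Representation.trivial ℂ ↥(torusU (conjLocal L (IsCMField.complexConj L) v) (cmLocalForm L 2 v)) ℂ).twist (torusCharPair (conjLocal L (IsCMField.complexConj L) v) (cmLocalForm L 2 v) (cmLocalForm_eq_over L 2 v) 0 χ₁ χ₂)) hδ,
      fun m x hx => normalizedJacquet_mem_evalJacquetKer (cmBorelTriple L 2 v) ((Representation.trivial ℂ ↥(torusU (conjLocal L (IsCMField.complexConj L) v) (cmLocalForm L 2 v)) ℂ).twist (torusCharPair (conjLocal L (IsCMField.complexConj L) v) (cmLocalForm L 2 v) (cmLocalForm_eq_over L 2 v) 0 χ₁ χ₂)) hδ m hx,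
      fun m x => normalizedJacquet_sub_smul_mem_evalJacquetKer (cmBorelTriple L 2 v) ((Representation.trivial ℂ ↥(torusU (conjLocal L (IsCMField.complexConj L) v) (cmLocalForm L 2 v)) ℂ).twist (torusCharPair (conjLocal L (IsCMField.complexConj L) v) (cmLocalForm L 2 v) (cmLocalForm_eq_over L 2 v) 0 χ₁ χ₂)) hδ (torusCharPair (conjLocal L (IsCMField.complexConj L) v) (cmLocalForm L 2 v) (cmLocalForm_eq_over L 2 v) 0 χ₁ χ₂)
        (fun m w => by rw [Representation.twist_apply, Representation.trivial_apply]) m x,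
      finiteDimensional_quotient_evalJacquetKer (cmBorelTriple L 2 v) ((Representation.trivial ℂ ↥(torusU (conjLocal L (IsCMField.complexConj L) v) (cmLocalForm L 2 v)) ℂ).twist (torusCharPair (conjLocal L (IsCMField.complexConj L) v) (cmLocalForm L 2 v) (cmLocalForm_eq_over L 2 v) 0 χ₁ χ₂)) hδ,
      (finrank_quotient_evalJacquetKer_le (cmBorelTriple L 2 v) ((Representation.trivial ℂ ↥(torusU (conjLocal L (IsCMField.complexConj L) v) (cmLocalForm L 2 v)) ℂ).twist (torusCharPair (conjLocal L (IsCMField.complexConj L) v) (cmLocalForm L 2 v) (cmLocalForm_eq_over L 2 v) 0 χ₁ χ₂)) hδ).trans (Module.finrank_self ℂ).le,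
      fun x => mem_evalJacquetKer_iff (cmBorelTriple L 2 v) ((Representation.trivial ℂ ↥(torusU (conjLocal L (IsCMField.complexConj L) v) (cmLocalForm L 2 v)) ℂ).twist (torusCharPair (conjLocal L (IsCMField.complexConj L) v) (cmLocalForm L 2 v) (cmLocalForm_eq_over L 2 v) 0 χ₁ χ₂)) hδ x⟩
  -- (U)₂ the open-cell bound for every such `ℓ`
  have HU : ∀ ℓ : Submodule ℂ ((cmBorelTriple L 2 v).restrict (cmPrincipalSeries L 2 v (torusCharPair (conjLocal L (IsCMField.complexConj L) v) (cmLocalForm L 2 v) (cmLocalForm_eq_over L 2 v) 0 χ₁ χ₂))).Coinvariants,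
      (∀ x, x ∈ ℓ ↔ ∃ f : Representation.SmoothInd (cmBorelTriple L 2 v).P
          (Representation.twist
          (((Representation.trivial ℂ ↥(torusU (conjLocal L (IsCMField.complexConj L) v) (cmLocalForm L 2 v)) ℂ).twist
            (torusCharPair (conjLocal L (IsCMField.complexConj L) v) (cmLocalForm L 2 v) (cmLocalForm_eq_over L 2 v) 0 χ₁ χ₂)).comp (cmBorelTriple L 2 v).proj) (rootDeltaChar (cmBorelTriple L 2 v).P)),
        f.toFun 1 = 0 ∧ Representation.Coinvariants.mk ((cmBorelTriple L 2 v).restrict (cmPrincipalSeries L 2 v (torusCharPair (conjLocal L (IsCMField.complexConj L) v) (cmLocalForm L 2 v) (cmLocalForm_eq_over L 2 v) 0 χ₁ χ₂))) f = x) →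
      FiniteDimensional ℂ ↥ℓ ∧ Module.finrank ℂ ↥ℓ ≤ 1 := by
    intro ℓ hℓ
    have H := Representation.finrank_le_of_forall_mem_iff_exists_toFun_one_eq_zero_normalizedInd (cmBorelTriple L 2 v)
      ((Representation.trivial ℂ ↥(torusU (conjLocal L (IsCMField.complexConj L) v) (cmLocalForm L 2 v)) ℂ).twist (torusCharPair (conjLocal L (IsCMField.complexConj L) v) (cmLocalForm L 2 v) (cmLocalForm_eq_over L 2 v) 0 χ₁ χ₂)) w₀ hN hB hS ℓ hℓ
    obtain ⟨hfd, hle⟩ := H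
    refine ⟨hfd, ?_⟩
    have hle' : Module.finrank ℂ ↥ℓ ≤ Module.finrank ℂ ℂ := hle
    have h1 : Module.finrank ℂ ℂ = 1 := Module.finrank_self ℂ
    omega

  -- (L-q)₂ the evaluation functional `E ∘ [·] = ev₁`
  have HE := HL2
  -- `r_B = χ · id` (★ generic §2 of the N = 3 twin, over the packages)
  have hscalar : ∀ (m : ↥(cmBorelTriple L 2 v).M)
      (x : ((cmBorelTriple L 2 v).restrict (cmPrincipalSeries L 2 v (torusCharPair (conjLocal L (IsCMField.complexConj L) v) (cmLocalForm L 2 v) (cmLocalForm_eq_over L 2 v) 0 χ₁ χ₂))).Coinvariants),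
      (cmPrincipalSeries L 2 v (torusCharPair (conjLocal L (IsCMField.complexConj L) v) (cmLocalForm L 2 v) (cmLocalForm_eq_over L 2 v) 0 χ₁ χ₂)).normalizedJacquet (cmBorelTriple L 2 v) m x =
        ((torusCharPair (conjLocal L (IsCMField.complexConj L) v) (cmLocalForm L 2 v) (cmLocalForm_eq_over L 2 v) 0 χ₁ χ₂ m : ℂˣ) : ℂ) • x :=
    apply_eq_smul_of_one_vector
      (mk := ⇑(Representation.Coinvariants.mk ((cmBorelTriple L 2 v).restrict (cmPrincipalSeries L 2 v (torusCharPair (conjLocal L (IsCMField.complexConj L) v) (cmLocalForm L 2 v) (cmLocalForm_eq_over L 2 v) 0 χ₁ χ₂)))))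
      (ev := fun f => f.toFun 1)
      (J := fun m => ⇑((cmPrincipalSeries L 2 v (torusCharPair (conjLocal L (IsCMField.complexConj L) v) (cmLocalForm L 2 v) (cmLocalForm_eq_over L 2 v) 0 χ₁ χ₂)).normalizedJacquet (cmBorelTriple L 2 v) m))
      (χc := fun m => ((torusCharPair (conjLocal L (IsCMField.complexConj L) v) (cmLocalForm L 2 v) (cmLocalForm_eq_over L 2 v) 0 χ₁ χ₂ m : ℂˣ) : ℂ))
      (wχc := fun m => ((weylTorusCharPair (conjLocal L (IsCMField.complexConj L) v) (cmLocalForm L 2 v) (cmLocalForm_eq_over L 2 v) 0 χ₁ χ₂ m : ℂˣ) : ℂ))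
      (fun m x y => map_add _ x y) (fun m c x => map_smul _ c x)
      HC HU hT (fun m => by rw [hw]) HE f₀ hf₀ hJf₀
  -- the functional `φ` (★ generic §2) and `ℓ := φ ∘ [·]` (★ generic §1)
  obtain ⟨φ, hφ⟩ := exists_functional_comp_not_proportional
    (mk := ⇑(Representation.Coinvariants.mk ((cmBorelTriple L 2 v).restrict (cmPrincipalSeries L 2 v (torusCharPair (conjLocal L (IsCMField.complexConj L) v) (cmLocalForm L 2 v) (cmLocalForm_eq_over L 2 v) 0 χ₁ χ₂)))))
    (ev := fun f => f.toFun 1) HD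
  refine ⟨φ ∘ₗ Representation.Coinvariants.mk ((cmBorelTriple L 2 v).restrict (cmPrincipalSeries L 2 v (torusCharPair (conjLocal L (IsCMField.complexConj L) v) (cmLocalForm L 2 v) (cmLocalForm_eq_over L 2 v) 0 χ₁ χ₂))),
    fun p f => eigenfunctional_comp_mk_of_scalar (cmBorelTriple L 2 v) hN
      (cmPrincipalSeries L 2 v (torusCharPair (conjLocal L (IsCMField.complexConj L) v) (cmLocalForm L 2 v) (cmLocalForm_eq_over L 2 v) 0 χ₁ χ₂))
      (torusCharPair (conjLocal L (IsCMField.complexConj L) v) (cmLocalForm L 2 v) (cmLocalForm_eq_over L 2 v) 0 χ₁ χ₂) hscalar φ p f, fun c => ?_⟩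
  obtain ⟨f, hf⟩ := hφ c
  exact ⟨f, hf⟩

end CM

end Summit.HodgeConjecture.HodgeConjecture.R90.S4

end
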